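import Summits.QuantumFields.BalabanUV.T4Continuum.Spine.NE5.NeumannLevelSums

/-!
# Spine/NE5/NeumannPencilCovariance — T9: the COVARIANCE `(A + tP)⁻¹` along row NE5's precision pencil is a walk-majorant
# family with t-INDEPENDENT letters, from the walk data of `A⁻¹` and of the pencil direction `P` and ONE margin smallness
# (cell `pub-balaban-gaps`, seat `ne5` gen 5; assembles `ProductWalks` + `NeumannChainWalks` + `NeumannLevelSums`)

WHY (`HOME/pub-balaban-gaps-ne5/T9-DESIGN.md`).  `Spine/NE5/TwoRunPencilWalks` (p351621 ✓) puts NE5's W2 pencil in the class by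
LINEARITY for the Γ-kernel and the precision `A_t = A + tP`; the covariance `(A_t)⁻¹` is not linear in `t`.  Print's mechanism is
the resolvent ∕ Neumann series with every operator walk-expanded ([B9] (3.130) p. 421 and p. 422 *"we replace each operator in
(3.130) by its random walk expansion … each operator Δ′_π provides the small factor"*; [II] p. 13).  THIS FILE: given entrywise
walk expansions of `C = A⁻¹` (terms `T_C`, per-term rate `ρ_C`, partial sums at rate `r_C`) and of `P` (terms `T_P`, rates
`ρ_P`, `r_P`), all walk distances dominating `d₁`, `A·C = 1` on polydisc × ball, a chain rate `ρ` inside BOTH drop windows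
(`r_C, r_P ≤ ρ`, `ρ + σ₁ ≤ ρ_s ≤ ρ_C`, `ρ_s + σ₁ ≤ ρ_P`) and the smallness `q = (mc₁)·θ̄·c′ < 1`, `θ̄ = (mc₁)·K̄_C·(τK̄_P)·c′`,
the family of CHAINS `T_C(ω₂)(−tT_P(ω₁)) ⋯ T_C(ω₀)` indexed by `List (W_C × W_P) × W_C` is a `WalkMajorants` family of
`(A + tP)⁻¹` for every `‖t‖ ≤ τ`: `hasSum` by `NeumannLevelSums` (levels `KⁿC`, `K = −tCP`, remainder → 0, `(1 − K)X = C`,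
`A(1 − K) = A + tP`), `maj` by `NeumannChainWalks.norm_chain_entry_le`, `majSum` by `majSumLe_chain` — constant `K̄_C(1 − q)⁻¹`,
rate `ρ`, torus rate `κ`, all INDEPENDENT of `t` (and of the two-run rate `r_j` once `τ = rOp∕r_j`, `τ·r_j·K̄_E = rOp·K̄_E`).

HONEST FRAMING.  Bookkeeping over hypothesis SHAPES and the tree's [B9] Sect. D walk algebra; every family, rate and constant is a
HYPOTHESIS ∕ parameter; nothing of Bałaban's is constructed or asserted (whether his precision ∕ covariance at two spacings admit such
data, with a common drop window, is NODE O + row NE2 — typing point (x5)); NE5 NOT PRINTED ∕ NOT PROVED; (D4) NOT discharged;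
spine PROVED 0∕9; rung (B)+1 on a FIXED finite T⁴ — NOT continuum, NOT infinite volume, NOT mass gap, NOT Clay.  HONEST DEPENDENCY:
continuum YM on T⁴ ⇐ BetaPertH ∧ nine spine estimates; BetaPertH ⇐ (D1) ∧ (D4) ∧ CAP+tail.  0 sorry, 0 def.

Sources: [B9] = T. Bałaban, CMP **99** (1985) [Balaban1985BackgroundPropagators] (3.92)–(3.94) p. 410, (3.107)–(3.108) p. 416, (3.130)
p. 421, p. 422; [B6] = CMP **96** (1984) [Balaban1984PropagatorsII] (2.61) p. 234; [II] = CMP **116** (1988) [Balaban1988RG2Cluster]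
(1.5) p. 3, p. 13, p. 17.  Nothing here is a claim about the Yang–Mills mass gap.
-/

noncomputable section

namespace Summit.QuantumFields.BalabanUV.T4Continuum.Spine.NE5.NeumannPencilCovariance

open Metric Set Finset
open Literature.MathematicalPhysics.QuantumFieldTheory.Balaban1983to89
open Literature.MathematicalPhysics.QuantumFieldTheory.Balaban1983to89.B9SectDWalk
  (MajSumLe DomBy infConv chainConst chainDist)
open Literature.MathematicalPhysics.QuantumFieldTheory.Balaban1983to89.B9Thm34Ext (toB6)
open Literature.MathematicalPhysics.QuantumFieldTheory.Balaban1983to89.B9Thm37GlueTorus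
  (torusGeom tdist1 tdist1_nonneg hdnn_torusGeom htri_torusGeom)
open Literature.MathematicalPhysics.QuantumFieldTheory.Balaban1983to89.TreeLengthTorus (TPt)
open Literature.MathematicalPhysics.QuantumFieldTheory.Balaban1983to89.B5TorusCover (UT)
open Literature.MathematicalPhysics.QuantumFieldTheory.Balaban1983to89.B11SectG (RowSum)
open Literature.MathematicalPhysics.QuantumFieldTheory.Balaban1983to89.B13JointWalkExpansion (WalkMajorants)
open Summit.QuantumFields.BalabanUV.T4Continuum.Spine.NE5.ProductWalks
  (norm_mul_entry_le_of_walks_mirror majSumLe_mul walkMajorants_mul_mirror)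
open Summit.QuantumFields.BalabanUV.T4Continuum.Spine.NE5.NeumannChainWalks (norm_chain_entry_le majSumLe_chain chainDist_nonneg)
open Summit.QuantumFields.BalabanUV.T4Continuum.Spine.NE5.NeumannLevelSums (hasSum_levels one_sub_mul_tsum_eq)

variable {ν : ℕ} {Nf : Fin ν → ℕ} [∀ i, NeZero (Nf i)]
variable {d N' : ℕ} {n : Type} [Fintype n] [DecidableEq n]
variable {E : Type*} [NormedAddCommGroup E] [NormedSpace ℂ E]
variable {c₀ : B13.Consts} {locn : n → UT Nf}
variable {WC WP : Type}
variable {TC : WC → (TPt d N' → ℂ) → E → Matrix n n ℂ} {Cm : (TPt d N' → ℂ) → E → Matrix n n ℂ}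
variable {AC : WC → ℝ} {DC : WC → UT Nf → UT Nf → ℝ}
variable {TP : WP → (TPt d N' → ℂ) → E → Matrix n n ℂ} {Pm : (TPt d N' → ℂ) → E → Matrix n n ℂ}
variable {AP : WP → ℝ} {DP : WP → UT Nf → UT Nf → ℝ}
variable {A : (TPt d N' → ℂ) → E → Matrix n n ℂ}
variable {R ρC rC κC KbarC ρP rP κP KbarP ρ ρs σ₁ c₁ σ' c' κs κ τ : ℝ} {m : ℕ} {t : ℂ}

omit [∀ i, NeZero (Nf i)] [Fintype n] [DecidableEq n] [NormedSpace ℂ E] in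
/-- The t-scaled pencil direction keeps its walk shape with amplitudes `τ·A_P` (`‖t‖ ≤ τ`). [folklore] -/
theorem norm_smul_term_le (hPmaj : ∀ ω, ∀ σ₀ : TPt d N' → ℂ, (∀ j, ‖σ₀ j‖ ≤ Real.exp c₀.κ₁) → ∀ u ∈ ball (0 : E) R,
      ∀ i k, ‖TP ω σ₀ u i k‖ ≤ AP ω * Real.exp (-(ρP * DP ω (locn i) (locn k))))
    (ht : ‖t‖ ≤ τ) (ω : WP) (σ₀ : TPt d N' → ℂ) (hσ₀ : ∀ j, ‖σ₀ j‖ ≤ Real.exp c₀.κ₁)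
    (u : E) (hu : u ∈ ball (0 : E) R) (i k : n) :
    ‖((-t) • TP ω σ₀ u) i k‖ ≤ τ * AP ω * Real.exp (-(ρP * DP ω (locn i) (locn k))) := by
  rw [Matrix.smul_apply, smul_eq_mul, norm_mul, norm_neg, mul_assoc]
  exact mul_le_mul ht (hPmaj ω σ₀ hσ₀ u hu i k) (norm_nonneg _) ((norm_nonneg t).trans ht)

omit [NormedSpace ℂ E] in
/-- **T9 — THE COVARIANCE ALONG THE PENCIL IS A WALK-MAJORANT FAMILY WITH t-INDEPENDENT LETTERS.**  See the module docstring for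
the data and the rate bookkeeping; the conclusion is a `B13JointWalkExpansion.WalkMajorants` for `(σ,u) ↦ (A(σ,u) + t·P(σ,u))⁻¹`
whose terms are the Neumann chains, amplitudes `chainConst m c₁ θ (A_C ω₀) l`, walk distances `chainDist`, rate `ρ`, constant
`K̄_C(1 − q)⁻¹`, torus rate `κ`. [cite: Balaban1985BackgroundPropagators, (3.130) p.421, p.422, (3.107)–(3.108) p.416; Balaban1988RG2Cluster, (1.5) p.3, p.13] -/
theorem walkMajorants_inv_pencil
    (hCsum : ∀ σ₀ : TPt d N' → ℂ, (∀ j, ‖σ₀ j‖ ≤ Real.exp c₀.κ₁) → ∀ u ∈ ball (0 : E) R,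
      ∀ i k, HasSum (fun ω => TC ω σ₀ u i k) (Cm σ₀ u i k))
    (hCmaj : ∀ ω, ∀ σ₀ : TPt d N' → ℂ, (∀ j, ‖σ₀ j‖ ≤ Real.exp c₀.κ₁) → ∀ u ∈ ball (0 : E) R,
      ∀ i k, ‖TC ω σ₀ u i k‖ ≤ AC ω * Real.exp (-(ρC * DC ω (locn i) (locn k))))
    (hCms : MajSumLe (g := toB6 (torusGeom Nf 0 0 0) 0 True) (fun ω a b => AC ω * Real.exp (-(rC * DC ω a b)))
      (fun a b => KbarC * Real.exp (-(κC * tdist1 Nf a b))))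
    (hCdom : ∀ ω, DomBy (toB6 (torusGeom Nf 0 0 0) 0 True) (DC ω)) (hAC0 : ∀ ω, 0 ≤ AC ω)
    (hPsum : ∀ σ₀ : TPt d N' → ℂ, (∀ j, ‖σ₀ j‖ ≤ Real.exp c₀.κ₁) → ∀ u ∈ ball (0 : E) R,
      ∀ i k, HasSum (fun ω => TP ω σ₀ u i k) (Pm σ₀ u i k))
    (hPmaj : ∀ ω, ∀ σ₀ : TPt d N' → ℂ, (∀ j, ‖σ₀ j‖ ≤ Real.exp c₀.κ₁) → ∀ u ∈ ball (0 : E) R,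
      ∀ i k, ‖TP ω σ₀ u i k‖ ≤ AP ω * Real.exp (-(ρP * DP ω (locn i) (locn k))))
    (hPms : MajSumLe (g := toB6 (torusGeom Nf 0 0 0) 0 True) (fun ω a b => AP ω * Real.exp (-(rP * DP ω a b)))
      (fun a b => KbarP * Real.exp (-(κP * tdist1 Nf a b))))
    (hPdom : ∀ ω, DomBy (toB6 (torusGeom Nf 0 0 0) 0 True) (DP ω)) (hAP0 : ∀ ω, 0 ≤ AP ω)
    (hAC : ∀ σ₀ : TPt d N' → ℂ, (∀ j, ‖σ₀ j‖ ≤ Real.exp c₀.κ₁) → ∀ u ∈ ball (0 : E) R, A σ₀ u * Cm σ₀ u = 1)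
    (hfib : ∀ y : UT Nf, (Finset.univ.filter fun k => locn k = y).card ≤ m)
    (hrow : RowSum (toB6 (torusGeom Nf 0 0 0) 0 True) σ₁ c₁) (hrow' : RowSum (toB6 (torusGeom Nf 0 0 0) 0 True) σ' c')
    (hσ₁ : 0 ≤ σ₁) (hσ' : 0 ≤ σ') (hc₁ : 0 ≤ c₁) (hc' : 0 ≤ c')
    (hρ : 0 ≤ ρ) (hρs : ρ + σ₁ ≤ ρs) (hρsC : ρs ≤ ρC) (hρsP : ρs + σ₁ ≤ ρP) (hrC : rC ≤ ρ) (hrP : rP ≤ ρ)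
    (hKC : 0 ≤ KbarC) (hKP : 0 ≤ KbarP)
    (hκs : 0 ≤ κs) (hκsP : κs ≤ κP) (hκsC : κs + σ' ≤ κC) (hκ : 0 ≤ κ) (hκC : κ ≤ κC) (hκκs : κ + σ' ≤ κs)
    (hτ : 0 ≤ τ) (ht : ‖t‖ ≤ τ)
    (hq : (m * c₁) * ((m * c₁) * KbarC * (τ * KbarP) * c') * c' < 1) :
    WalkMajorants c₀ locn locn (fun σ₀ u => (A σ₀ u + t • Pm σ₀ u)⁻¹) R κ
      (KbarC * (1 - (m * c₁) * ((m * c₁) * KbarC * (τ * KbarP) * c') * c')⁻¹)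
      (fun (p : List (WC × WP) × WC) σ₀ u =>
        p.1.foldr (fun i M => (TC i.1 σ₀ u * ((-t) • TP i.2 σ₀ u)) * M) (TC p.2 σ₀ u))
      (fun p => chainConst (m : ℝ) c₁ (fun i : WC × WP => (m * c₁) * (AC i.1 * (τ * AP i.2))) (AC p.2) p.1)
      (fun p => chainDist (g := toB6 (torusGeom Nf 0 0 0) 0 True)
        (fun i : WC × WP => infConv (g := toB6 (torusGeom Nf 0 0 0) 0 True) (DC i.1) (DP i.2)) (DC p.2) p.1) ρ := by
  -- abbreviations
  have hρC' : ρ ≤ ρC := by linarith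
  have hρsP' : ρs ≤ ρP := by linarith
  have hτAP : ∀ ω, 0 ≤ τ * AP ω := fun ω => mul_nonneg hτ (hAP0 ω)
  have hθ : ∀ i : WC × WP, 0 ≤ (m * c₁) * (AC i.1 * (τ * AP i.2)) :=
    fun i => mul_nonneg (mul_nonneg (Nat.cast_nonneg m) hc₁) (mul_nonneg (hAC0 _) (hτAP _))
  have hDstep : ∀ i : WC × WP, DomBy (toB6 (torusGeom Nf 0 0 0) 0 True)
      (infConv (g := toB6 (torusGeom Nf 0 0 0) 0 True) (DC i.1) (DP i.2)) :=
    fun i => B9SectDWalk.domBy_infConv (htri_torusGeom 0 0 0 0 True) (hCdom i.1) (hPdom i.2)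
  -- the t-scaled direction: sums, bounds, partial sums
  have hP'sum : ∀ σ₀ : TPt d N' → ℂ, (∀ j, ‖σ₀ j‖ ≤ Real.exp c₀.κ₁) → ∀ u ∈ ball (0 : E) R,
      ∀ i k, HasSum (fun ω => ((-t) • TP ω σ₀ u) i k) (((-t) • Pm σ₀ u) i k) := by
    intro σ₀ hσ₀ u hu i k
    simp only [Matrix.smul_apply, smul_eq_mul]
    exact (hPsum σ₀ hσ₀ u hu i k).mul_left _
  have hP'maj := norm_smul_term_le (locn := locn) hPmaj ht
  have hP'ms : MajSumLe (g := toB6 (torusGeom Nf 0 0 0) 0 True) (fun ω a b => (τ * AP ω) * Real.exp (-(rP * DP ω a b)))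
      (fun a b => (τ * KbarP) * Real.exp (-(κP * tdist1 Nf a b))) := by
    intro S a b
    have h := hPms S a b
    calc ∑ ω ∈ S, τ * AP ω * Real.exp (-(rP * DP ω a b)) = τ * ∑ ω ∈ S, AP ω * Real.exp (-(rP * DP ω a b)) := by
          rw [Finset.mul_sum]; exact Finset.sum_congr rfl fun ω _ => by ring
      _ ≤ τ * (KbarP * Real.exp (-(κP * tdist1 Nf a b))) := mul_le_mul_of_nonneg_left h hτ
      _ = (τ * KbarP) * Real.exp (-(κP * tdist1 Nf a b)) := by ring
  -- the STEP family `S_(ω₂,ω₁) = T_C ω₂ · (−t T_P ω₁)` (mirror product: the direction pays inside the step)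
  have hStep := walkMajorants_mul_mirror (Nf := Nf) (c₀ := c₀) (locp := locn) (locn := locn) (locq := locn)
    (K₁ := Cm) (K₂ := fun σ₀ u => (-t) • Pm σ₀ u) (T₁ := TC) (T₂ := fun ω σ₀ u => (-t) • TP ω σ₀ u)
    (A₁ := AC) (A₂ := fun ω => τ * AP ω) (D₁ := DC) (D₂ := DP)
    hCsum hP'sum hCmaj hP'maj hCms hP'ms hAC0 hτAP (fun ω a b => (hdnn_torusGeom 0 0 0 a b).trans (hCdom ω a b))
    (fun ω a b => (hdnn_torusGeom 0 0 0 a b).trans (hPdom ω a b)) hPdom hfib hrow hrow'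
    (hρ.trans (by linarith)) hρsC hσ₁ hρsP (hrC.trans (by linarith)) (hrP.trans (by linarith)) hKC (mul_nonneg hτ hKP)
    hκs hκsP hκsC hc₁
  -- step partial sums AT THE CHAIN RATE ρ (inside both drop windows)
  have hStepMS := majSumLe_mul (Nf := Nf) (C := m * c₁) (A₁ := AC) (A₂ := fun ω => τ * AP ω) (D₁ := DC) (D₂ := DP)
    hAC0 hτAP (fun ω a b => (hdnn_torusGeom 0 0 0 a b).trans (hCdom ω a b))
    (fun ω a b => (hdnn_torusGeom 0 0 0 a b).trans (hPdom ω a b)) hrC hrP (mul_nonneg (Nat.cast_nonneg m) hc₁) hKC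
    (mul_nonneg hτ hKP) hκs hκsP hκsC hrow' hCms hP'ms
  -- the total majorant and its partial sums (chains: every step pays its own boundary)
  have hchainMS := majSumLe_chain (Nf := Nf) (ι := WC × WP) (W₀ := WC) (m := m)
    (θ := fun i : WC × WP => (m * c₁) * (AC i.1 * (τ * AP i.2)))
    (D := fun i : WC × WP => infConv (g := toB6 (torusGeom Nf 0 0 0) 0 True) (DC i.1) (DP i.2)) (A₀ := AC) (D₀ := DC)
    (ρ := ρ) (r := ρ) (r₀ := rC) (c := c₁)
    hθ hAC0 hc₁ le_rfl hrC hDstep hCdom hrow' hσ'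
    (mul_nonneg (mul_nonneg (mul_nonneg (mul_nonneg (Nat.cast_nonneg m) hc₁) hKC) (mul_nonneg hτ hKP)) hc') hKC hκ hκC hκκs
    (by
      intro S a b
      have h := hStepMS S a b
      simpa only [mul_assoc] using h)
    hCms hq
  refine
    { hasSum := ?_
      maj := ?_
      majSum := by
        intro S a b
        simpa only [mul_assoc] using hchainMS S a b
      A_nonneg := fun p => B9SectDWalk.chainConst_nonneg (Nat.cast_nonneg m) hc₁ hθ (hAC0 p.2) p.1 }
  · -- hasSum: levels KⁿC, remainder → 0, (1 − K)X = C, A(1 − K) = A + tP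
    intro σ₀ hσ₀ u hu i j
    have hSsum : ∀ a k, HasSum (fun ι' : WC × WP => (TC ι'.1 σ₀ u * ((-t) • TP ι'.2 σ₀ u)) a k)
        ((Cm σ₀ u * ((-t) • Pm σ₀ u)) a k) := fun a k => hStep.hasSum σ₀ hσ₀ u hu a k
    have hSmaj : ∀ (ι' : WC × WP) a k, ‖(TC ι'.1 σ₀ u * ((-t) • TP ι'.2 σ₀ u)) a k‖ ≤
        ((m * c₁) * (AC ι'.1 * (τ * AP ι'.2))) *
          Real.exp (-(ρs * infConv (g := toB6 (torusGeom Nf 0 0 0) 0 True) (DC ι'.1) (DP ι'.2) (locn a) (locn k))) :=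
      fun ι' a k => hStep.maj ι' σ₀ hσ₀ u hu a k
    have hMtot : ∀ (p : List (WC × WP) × WC) a b,
        ‖(p.1.foldr (fun i M => (TC i.1 σ₀ u * ((-t) • TP i.2 σ₀ u)) * M) (TC p.2 σ₀ u)) a b‖ ≤
          chainConst (m : ℝ) c₁ (fun i : WC × WP => (m * c₁) * (AC i.1 * (τ * AP i.2))) (AC p.2) p.1 *
            Real.exp (-(ρ * chainDist (g := toB6 (torusGeom Nf 0 0 0) 0 True)
              (fun i : WC × WP => infConv (g := toB6 (torusGeom Nf 0 0 0) 0 True) (DC i.1) (DP i.2)) (DC p.2) p.1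
                (locn a) (locn b))) := fun p a b =>
      norm_chain_entry_le (Nf := Nf) locn locn hfib hθ (hAC0 p.2) hρ hσ₁ hρs hDstep (hCdom p.2) hrow hSmaj
        (fun a b => (hCmaj p.2 σ₀ hσ₀ u hu a b).trans (mul_le_mul_of_nonneg_left (Real.exp_le_exp.2 (neg_le_neg
          (mul_le_mul_of_nonneg_right hρC' ((hdnn_torusGeom 0 0 0 _ _).trans (hCdom p.2 _ _))))) (hAC0 p.2))) p.1 a b
    have hBtot : ∀ (F : Finset (List (WC × WP) × WC)) a b, ∑ p ∈ F,
        chainConst (m : ℝ) c₁ (fun i : WC × WP => (m * c₁) * (AC i.1 * (τ * AP i.2))) (AC p.2) p.1 *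
          Real.exp (-(ρ * chainDist (g := toB6 (torusGeom Nf 0 0 0) 0 True)
            (fun i : WC × WP => infConv (g := toB6 (torusGeom Nf 0 0 0) 0 True) (DC i.1) (DP i.2)) (DC p.2) p.1
              (locn a) (locn b))) ≤
        KbarC * (1 - (m * c₁) * ((m * c₁) * KbarC * (τ * KbarP) * c') * c')⁻¹ * Real.exp (-(κ * tdist1 Nf (locn a) (locn b))) :=
      fun F a b => by simpa only [mul_assoc] using hchainMS F (locn a) (locn b)
    have hlev := hasSum_levels (S := fun i : WC × WP => TC i.1 σ₀ u * ((-t) • TP i.2 σ₀ u)) (T := fun ω => TC ω σ₀ u)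
      hSsum (σS := fun ι' a k => ((m * c₁) * (AC ι'.1 * (τ * AP ι'.2))) *
          Real.exp (-(ρs * infConv (g := toB6 (torusGeom Nf 0 0 0) 0 True) (DC ι'.1) (DP ι'.2) (locn a) (locn k))))
      hSmaj (BS := fun a k => ((m * c₁) * KbarC * (τ * KbarP) * c') * Real.exp (-(κs * tdist1 Nf (locn a) (locn k))))
      (by
        intro F a k
        have h := hStep.majSum F (locn a) (locn k)
        simpa only [mul_assoc] using h)
      (fun k b => hCsum σ₀ hσ₀ u hu k b) hMtot hBtot i j
    have hid := one_sub_mul_tsum_eq (S := fun i : WC × WP => TC i.1 σ₀ u * ((-t) • TP i.2 σ₀ u)) (T := fun ω => TC ω σ₀ u)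
      hSsum (σS := fun ι' a k => ((m * c₁) * (AC ι'.1 * (τ * AP ι'.2))) *
          Real.exp (-(ρs * infConv (g := toB6 (torusGeom Nf 0 0 0) 0 True) (DC ι'.1) (DP ι'.2) (locn a) (locn k))))
      hSmaj (BS := fun a k => ((m * c₁) * KbarC * (τ * KbarP) * c') * Real.exp (-(κs * tdist1 Nf (locn a) (locn k))))
      (by
        intro F a k
        have h := hStep.majSum F (locn a) (locn k)
        simpa only [mul_assoc] using h)
      (fun k b => hCsum σ₀ hσ₀ u hu k b) hMtot hBtot
    -- (A + tP)·X = A·(1 − K)·X = A·C = 1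
    set X : Matrix n n ℂ := Matrix.of fun k b => ∑' p : List (WC × WP) × WC,
      (p.1.foldr (fun i M => (TC i.1 σ₀ u * ((-t) • TP i.2 σ₀ u)) * M) (TC p.2 σ₀ u)) k b with hXdef
    have hK : A σ₀ u * (1 - Cm σ₀ u * ((-t) • Pm σ₀ u)) = A σ₀ u + t • Pm σ₀ u := by
      rw [Matrix.mul_sub, Matrix.mul_one, Matrix.mul_smul, Matrix.mul_smul, ← Matrix.mul_assoc, hAC σ₀ hσ₀ u hu,
        Matrix.one_mul, neg_smul, sub_neg_eq_add]
    have hinv : (A σ₀ u + t • Pm σ₀ u) * X = 1 := by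
      rw [← hK, Matrix.mul_assoc, hid, hAC σ₀ hσ₀ u hu]
    have hX : (A σ₀ u + t • Pm σ₀ u)⁻¹ = X := Matrix.inv_eq_right_inv hinv
    rw [hX, hXdef, Matrix.of_apply]
    exact hlev.1.hasSum
  · -- maj
    intro p σ₀ hσ₀ u hu i j
    have hSmaj : ∀ (ι' : WC × WP) a k, ‖(TC ι'.1 σ₀ u * ((-t) • TP ι'.2 σ₀ u)) a k‖ ≤
        ((m * c₁) * (AC ι'.1 * (τ * AP ι'.2))) *
          Real.exp (-(ρs * infConv (g := toB6 (torusGeom Nf 0 0 0) 0 True) (DC ι'.1) (DP ι'.2) (locn a) (locn k))) :=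
      fun ι' a k => hStep.maj ι' σ₀ hσ₀ u hu a k
    exact norm_chain_entry_le (Nf := Nf) locn locn hfib hθ (hAC0 p.2) hρ hσ₁ hρs hDstep (hCdom p.2) hrow hSmaj
      (fun a b => (hCmaj p.2 σ₀ hσ₀ u hu a b).trans (mul_le_mul_of_nonneg_left (Real.exp_le_exp.2 (neg_le_neg
        (mul_le_mul_of_nonneg_right hρC' ((hdnn_torusGeom 0 0 0 _ _).trans (hCdom p.2 _ _))))) (hAC0 p.2))) p.1 i j

/-! ## §2. Reach `s` at rate-free letters (the direction = the two runs' DIFFERENCE family at the two-run rate `r`) -/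

omit [NormedSpace ℂ E] in
/-- **T9 AT REACH `s`, UNIFORMLY IN THE TWO-RUN RATE.**  When the pencil direction is the two runs' precision DIFFERENCE family —
per-term bounds `r·A_E(ω)e^{−ρ_E D_E}` and partial sums `r·K̄_E e^{−κ_E d}` with the two-run rate `r > 0` (row NE2, termwise
walk-weighted currency) — and the pencil parameter ranges over `‖t‖ ≤ s∕r` (reach `s` = NE5's FIXED operator margin `rOp`), the
covariance `(A + tP)⁻¹` is a walk-majorant family whose letters do not mention `r`: step amplitudes `(mc₁)·A_C·(s·A_E)`, smallness
`q = (mc₁)·((mc₁)·K̄_C·(s·K̄_E)·c′)·c′ < 1`, constant `K̄_C(1 − q)⁻¹` — so as `r = r_j → 0` the Lemma-3 input for the covariance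
holds on the whole W2 pencil with ONE package (companion of `TwoRunPencilWalks.jointWalkExpansion_pencil_reach`).
[cite: Balaban1985BackgroundPropagators, (3.130) p.421, p.422; Balaban1988RG2Cluster, (1.5) p.3, (2.16) p.16, p.17] -/
theorem walkMajorants_inv_pencil_reach {AE : WP → ℝ} {KbarE r s : ℝ}
    (hCsum : ∀ σ₀ : TPt d N' → ℂ, (∀ j, ‖σ₀ j‖ ≤ Real.exp c₀.κ₁) → ∀ u ∈ ball (0 : E) R,
      ∀ i k, HasSum (fun ω => TC ω σ₀ u i k) (Cm σ₀ u i k))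
    (hCmaj : ∀ ω, ∀ σ₀ : TPt d N' → ℂ, (∀ j, ‖σ₀ j‖ ≤ Real.exp c₀.κ₁) → ∀ u ∈ ball (0 : E) R,
      ∀ i k, ‖TC ω σ₀ u i k‖ ≤ AC ω * Real.exp (-(ρC * DC ω (locn i) (locn k))))
    (hCms : MajSumLe (g := toB6 (torusGeom Nf 0 0 0) 0 True) (fun ω a b => AC ω * Real.exp (-(rC * DC ω a b)))
      (fun a b => KbarC * Real.exp (-(κC * tdist1 Nf a b))))
    (hCdom : ∀ ω, DomBy (toB6 (torusGeom Nf 0 0 0) 0 True) (DC ω)) (hAC0 : ∀ ω, 0 ≤ AC ω)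
    (hPsum : ∀ σ₀ : TPt d N' → ℂ, (∀ j, ‖σ₀ j‖ ≤ Real.exp c₀.κ₁) → ∀ u ∈ ball (0 : E) R,
      ∀ i k, HasSum (fun ω => TP ω σ₀ u i k) (Pm σ₀ u i k))
    (hPmaj : ∀ ω, ∀ σ₀ : TPt d N' → ℂ, (∀ j, ‖σ₀ j‖ ≤ Real.exp c₀.κ₁) → ∀ u ∈ ball (0 : E) R,
      ∀ i k, ‖TP ω σ₀ u i k‖ ≤ r * AE ω * Real.exp (-(ρP * DP ω (locn i) (locn k))))
    (hPms : MajSumLe (g := toB6 (torusGeom Nf 0 0 0) 0 True) (fun ω a b => r * AE ω * Real.exp (-(rP * DP ω a b)))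
      (fun a b => r * KbarE * Real.exp (-(κP * tdist1 Nf a b))))
    (hPdom : ∀ ω, DomBy (toB6 (torusGeom Nf 0 0 0) 0 True) (DP ω)) (hAE0 : ∀ ω, 0 ≤ AE ω)
    (hAC : ∀ σ₀ : TPt d N' → ℂ, (∀ j, ‖σ₀ j‖ ≤ Real.exp c₀.κ₁) → ∀ u ∈ ball (0 : E) R, A σ₀ u * Cm σ₀ u = 1)
    (hfib : ∀ y : UT Nf, (Finset.univ.filter fun k => locn k = y).card ≤ m)
    (hrow : RowSum (toB6 (torusGeom Nf 0 0 0) 0 True) σ₁ c₁) (hrow' : RowSum (toB6 (torusGeom Nf 0 0 0) 0 True) σ' c')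
    (hσ₁ : 0 ≤ σ₁) (hσ' : 0 ≤ σ') (hc₁ : 0 ≤ c₁) (hc' : 0 ≤ c')
    (hρ : 0 ≤ ρ) (hρs : ρ + σ₁ ≤ ρs) (hρsC : ρs ≤ ρC) (hρsP : ρs + σ₁ ≤ ρP) (hrC : rC ≤ ρ) (hrP : rP ≤ ρ)
    (hKC : 0 ≤ KbarC) (hKE : 0 ≤ KbarE)
    (hκs : 0 ≤ κs) (hκsP : κs ≤ κP) (hκsC : κs + σ' ≤ κC) (hκ : 0 ≤ κ) (hκC : κ ≤ κC) (hκκs : κ + σ' ≤ κs)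
    (hr : 0 < r) (hs : 0 ≤ s) (ht : ‖t‖ ≤ s / r)
    (hq : (m * c₁) * ((m * c₁) * KbarC * (s * KbarE) * c') * c' < 1) :
    WalkMajorants c₀ locn locn (fun σ₀ u => (A σ₀ u + t • Pm σ₀ u)⁻¹) R κ
      (KbarC * (1 - (m * c₁) * ((m * c₁) * KbarC * (s * KbarE) * c') * c')⁻¹)
      (fun (p : List (WC × WP) × WC) σ₀ u =>
        p.1.foldr (fun i M => (TC i.1 σ₀ u * ((-t) • TP i.2 σ₀ u)) * M) (TC p.2 σ₀ u))
      (fun p => chainConst (m : ℝ) c₁ (fun i : WC × WP => (m * c₁) * (AC i.1 * (s * AE i.2))) (AC p.2) p.1)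
      (fun p => chainDist (g := toB6 (torusGeom Nf 0 0 0) 0 True)
        (fun i : WC × WP => infConv (g := toB6 (torusGeom Nf 0 0 0) 0 True) (DC i.1) (DP i.2)) (DC p.2) p.1) ρ := by
  have e : ∀ x : ℝ, s / r * (r * x) = s * x := fun x => by rw [← mul_assoc, div_mul_cancel₀ s hr.ne']
  have hq' : (m * c₁) * ((m * c₁) * KbarC * (s / r * (r * KbarE)) * c') * c' < 1 := by rwa [e]
  have h := walkMajorants_inv_pencil (AP := fun ω => r * AE ω) (KbarP := r * KbarE) (τ := s / r)
    hCsum hCmaj hCms hCdom hAC0 hPsum hPmaj hPms hPdom (fun ω => mul_nonneg hr.le (hAE0 ω)) hAC hfib hrow hrow'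
    hσ₁ hσ' hc₁ hc' hρ hρs hρsC hρsP hrC hrP hKC (mul_nonneg hr.le hKE) hκs hκsP hκsC hκ hκC hκκs (div_nonneg hs hr.le) ht hq'
  simpa only [e] using h

end Summit.QuantumFields.BalabanUV.T4Continuum.Spine.NE5.NeumannPencilCovariance

end
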